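import Summits.MatrixMultiplication.MatrixMultiplication.Theses.OrbitHarmonicsHosts
import Summits.MatrixMultiplication.MatrixMultiplication.Theorems.OrbitHarmonicsHostsTruncatedPolynomialVacuityBorderRank
import Summits.MatrixMultiplication.MatrixMultiplication.Theorems.OrbitHarmonicsHostsTruncatedPolynomialVacuityDiagonal
import Literature.Computability.AlgebraicComplexity.SchoenhageTauBini
import Literature.Computability.AlgebraicComplexity.BorderRankRestriction
import Literature.Computability.AlgebraicComplexity.FlatteningBound

/-!
# `OrbitHarmonicsHosts.TruncatedPolynomialVacuity` (stmt-MatrixMultiplication-5457) — proved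

Route `MatrixMultiplication/OrbitHarmonicsHosts`, support item: non-equivariant hosting of
`⟨N,N,N⟩` in truncated polynomial rings at the `o(1)` level is EQUIVALENT to the summit,
`(∀ ε > 0, ∃ N ≥ 2, ∃ M ≤ N^{2+ε}, T_M ≥ ⟨N,N,N⟩) ↔ ω(ℂ) = 2`, where
`T_M(k,i,j) = [i+j=k]` on `Fin M` is the structure tensor of `ℂ[x]/(x^M)`.

* (→) `bR(⟨N,N,N⟩) ≤ bR(T_M) ≤ M` (`TensorRestrictsTo.algBorderRank_le` and the DFT
  approximate decomposition `algBorderRank_truncPoly_le`, helper file `…BorderRank`), so Bini's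
  theorem (`Blaser2013_thm66_holds.cubic`, proved in tree) gives `ω(ℂ) ≤ log_N M ≤ 2 + ε` for
  every `ε > 0`; with `omega_two_le` this is `ω(ℂ) = 2`.  (`M ≥ 1` because `⟨N,N,N⟩ ≠ 0`.)
* (←) `truncPoly_hosts_of_omega_eq_two` (helper file `…Diagonal`: `⟨N,N,N⟩ ≤ ⟨R(⟨N,N,N⟩)⟩ ≤ T_M`
  through a Behrend 3-AP-free set, `R(⟨N,N,N⟩) ≤ C N^{2+ε/4}` from `ω = 2`).
-/

-- the tree's namespace `Summit.MatrixMultiplication.MatrixMultiplication.…` repeats a component by design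
set_option linter.dupNamespace false

noncomputable section

namespace Summit.MatrixMultiplication.MatrixMultiplication.Theorems

open scoped BigOperators
open Literature.Computability.AlgebraicComplexity hiding MatrixMultiplication
open Summit.MatrixMultiplication.MatrixMultiplication.Theses.OrbitHarmonicsHosts

/-- **(→) of the vacuity equivalence**: if for every `ε > 0` some `⟨N,N,N⟩` (`N ≥ 2`) is a
restriction of `T_M` with `M ≤ N^{2+ε}`, then `ω(ℂ) ≤ 2` — border rank is monotone under
restriction, `bR(T_M) ≤ M`, and Bini's theorem. [folklore] -/
theorem omega_le_two_of_truncPoly_hosts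
    (H : ∀ ε : ℝ, 0 < ε → ∃ N M : ℕ, 2 ≤ N ∧ (M : ℝ) ≤ (N : ℝ) ^ (2 + ε) ∧
      TensorRestrictsTo (fun k i j : Fin M => if (i : ℕ) + j = k then (1 : ℂ) else 0)
        (matMulTensor ℂ N N N)) :
    omega ℂ ≤ 2 := by
  classical
  refine le_of_forall_pos_le_add fun ε hε => ?_
  obtain ⟨N, M, hN, hM, hres⟩ := H ε hε
  -- `M ≥ 1`: a restriction of a tensor of the empty format is `0`, but `⟨N,N,N⟩ ≠ 0`
  have hM1 : 1 ≤ M := by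
    rcases Nat.eq_zero_or_pos M with h0 | h0
    · exfalso
      subst h0
      obtain ⟨A, B, C, h⟩ := hres
      have h00 := h (⟨0, by omega⟩, ⟨0, by omega⟩) (⟨0, by omega⟩, ⟨0, by omega⟩)
        (⟨0, by omega⟩, ⟨0, by omega⟩)
      simp [matMulTensor] at h00
    · exact h0
  have hbr : algBorderRank (matMulTensor ℂ N N N) ≤ M :=
    hres.algBorderRank_le.trans (algBorderRank_truncPoly_le M)
  have hω : omega ℂ ≤ Real.logb N M := Blaser2013_thm66_holds.cubic ℂ hN hM1 hbr
  have hN1 : (1 : ℝ) < N := by exact_mod_cast (lt_of_lt_of_le (by norm_num) hN)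
  have hMpos : (0 : ℝ) < M := by exact_mod_cast hM1
  calc omega ℂ ≤ Real.logb N M := hω
    _ ≤ Real.logb N ((N : ℝ) ^ (2 + ε)) := Real.logb_le_logb_of_le hN1 hMpos hM
    _ = 2 + ε := Real.logb_rpow (by linarith) (ne_of_gt hN1)

/-- **`TruncatedPolynomialVacuity`** (route `OrbitHarmonicsHosts`, item
`stmt-MatrixMultiplication-5457`): single-shot non-equivariant hosting of `⟨N,N,N⟩` in the
truncated polynomial rings `ℂ[x]/(x^M)` with `M ≤ N^{2+ε}` for every `ε > 0` is equivalent to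
`ω(ℂ) = 2` (the summit statement `MatrixMultiplication`). [folklore] -/
theorem truncatedPolynomialVacuity_proof : TruncatedPolynomialVacuity := by
  unfold TruncatedPolynomialVacuity
  constructor
  · intro H
    show omega ℂ = 2
    exact le_antisymm (omega_le_two_of_truncPoly_hosts H) (omega_two_le ℂ)
  · intro hω ε hε
    have hω' : omega ℂ = 2 := hω
    exact truncPoly_hosts_of_omega_eq_two hω' hε

end Summit.MatrixMultiplication.MatrixMultiplication.Theorems

end
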